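import Literature.IUT.HodgeTheaters.ThetaPMEllGluingRigidityLaw
import HarnessLib

/-!
# [IUTchI] Remark 6.12.2 (ii) / Definition 6.13 (i)(c), concluded: NECESSITY of the label-rigidity law
# (a collision of Example 4.4's poly-morphisms that persists at every bad place destroys uniqueness)

S. Mochizuki, *Inter-universal Teichmüller theory I*, §6, Remark 6.12.2 (i), (ii) p. 174; §4, Example 4.4
(ii)–(iv) p. 107, Proposition 6.7 p. 167, kurims manuscript (May 2020) ([IUTchI] Rmk 6.12.2 (ii) p.174)
[claim: Mochizuki2012, status: disputed].  Third part of abc-iut-w4-d056's consistency analysis of the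
typed `S5Local.GluingUnique` (`ThetaPMEllGluingRigidity.lean`: uniqueness ⇐ label-rigidity, and a kit
with `𝕍^bad ≠ ∅` where uniqueness fails; `ThetaPMEllGluingRigidityLaw.lean`: the exact kit law —
injectivity in the label of the bi-saturated `MultKit.thetaPolyBad` at one bad place — suffices).  No IUT
content is asserted; no side is taken.

## What is proved here (theorems only; hypotheses inline)

* `transport_eq_image_biSaturation` (pure category theory): the family transported along arbitrary
  isomorphisms is the image of the bi-saturation under composition with fixed isomorphisms.
* `thetaBridgeData_labelFamily_eq_of_not_bad`: at a good place Proposition 6.7's composite family is the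
  set of ALL isomorphisms — label-blind ("the corresponding full poly-isomorphisms", Prop 6.7;
  Ex 4.4 (iii)); `thetaBridgeData_labelFamily_eq_of_collision`: at a bad place a collision of the kit
  law for two labels makes the two composite families coincide.
* `exists_thetaGluing_trans_of_familyPreserving` / `not_subsingleton_thetaGluing_of_familyPreserving`:
  a relabeling of `T^⋆` preserving every Prop-6.7 family carries gluings to gluings, so a non-trivial
  one contradicts uniqueness as soon as one gluing exists.
* `not_gluingUnique_of_uniform_collision`: if some pair `(B, H)` admits a gluing and two distinct
  classes `q₁ ≠ q₂ ∈ T^⋆` have colliding kit data at EVERY bad place, then `GluingUnique` FAILS.  With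
  `gluingUnique_of_thetaPolyBad_labelRigid` (prequel) this brackets Rmk 6.12.2 (ii) between «the law
  holds at one bad place» (sufficient) and «the law fails by one and the same collision at all bad
  places» (refuting, given a gluing) — for a single bad place, a dichotomy.

Proof-only: no `def`, no new `Prop` fact. typed ≠ proved.
-/

namespace Literature.IUT.HodgeTheaters

open CategoryTheory

universe u

namespace PMBaseKit

/-! ### A label collision that persists at every bad place destroys uniqueness -/

section Necessity

variable {C : Type*} [Category C]

/-- Pure category theory: the family transported along arbitrary isomorphisms `X ⥲ Y`, `Y ⥲ Z` is the
image of the bi-saturation on `Y` under `k ↦ ψ₀ ≫ k ≫ β₁` for FIXED `ψ₀ : X ⥲ Y`, `β₁ : Y ⥲ Z`.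
([IUTchI] Ex 4.4 (ii) p.107) [claim: Mochizuki2012, status: disputed] -/
theorem transport_eq_image_biSaturation {X Y Z : C} (ψ₀ : X ≅ Y) (β₁ : Y ≅ Z) (S : Set (Y ⟶ Y)) :
    {h : X ⟶ Z | ∃ (ψ : X ≅ Y) (g : Y ⟶ Y) (β : Y ≅ Z), g ∈ S ∧ h = ψ.hom ≫ g ≫ β.hom} =
      (fun k => ψ₀.hom ≫ k ≫ β₁.hom) ''
        {k : Y ⟶ Y | ∃ (θ : Y ≅ Y) (g : Y ⟶ Y) (β : Y ≅ Y), g ∈ S ∧ k = θ.hom ≫ g ≫ β.hom} := by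
  ext h
  simp only [Set.mem_setOf_eq, Set.mem_image]
  constructor
  · rintro ⟨ψ, g, β, hg, rfl⟩
    exact ⟨(ψ₀.symm ≪≫ ψ).hom ≫ g ≫ (β ≪≫ β₁.symm).hom, ⟨ψ₀.symm ≪≫ ψ, g, β ≪≫ β₁.symm, hg, rfl⟩,
      by simp⟩
  · rintro ⟨k, ⟨θ, g, β, hg, rfl⟩, rfl⟩
    exact ⟨ψ₀ ≪≫ θ, g, β ≪≫ β₁, hg, by simp⟩

end Necessity

namespace FKit.ThetaPMBridge

variable {l : ℕ} {K : PMBaseKit.{u} l} {M : K.MultKit} {FK : K.FKit M} (B : FK.ThetaPMBridge)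

/-- At a GOOD place `v ∉ 𝕍^bad`, Proposition 6.7's poly-morphism is "the corresponding full
poly-morphism" ([IUTchI] Prop 6.7 p. 167), so the composite family at an isomorph `X` of `𝒟_v` is the
set of ALL isomorphisms `X ⥲ †𝒟_{≻,v}` — independent of the label `q`.
([IUTchI] Prop 6.7 p.167) [claim: Mochizuki2012, status: disputed] -/
theorem thetaBridgeData_labelFamily_eq_of_not_bad (hl : Odd l) {v : K.V} (hv : v ∉ K.bad)
    (q : B.grpT.AbsStar) (X : K.Amb v) :
    {h : X ⟶ B.codomain.assocD.obj v |
        ∃ (φ : X ≅ ((B.starCapsule q).assocD).obj v)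
          (g : ((B.starCapsule q).assocD).obj v ⟶ B.codomain.assocD.obj v),
          g ∈ (B.dBridge.thetaBridgeData M hl).poly ⟨q⟩ v ∧ h = φ.hom ≫ g} =
      {h : X ⟶ B.codomain.assocD.obj v | ∃ e : X ≅ B.codomain.assocD.obj v, h = e.hom} := by
  ext h
  constructor
  · rintro ⟨φ, g', hg', rfl⟩
    simp only [DThetaPMBridge.thetaBridgeData, dif_neg hv] at hg'
    obtain ⟨f, rfl⟩ := hg'
    exact ⟨φ ≪≫ f, by simp⟩
  · rintro ⟨e, rfl⟩
    obtain ⟨γY⟩ := ((B.starCapsule q).assocD).isLocal v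
    obtain ⟨γZ⟩ := B.codomain.assocD.isLocal v
    refine ⟨e ≪≫ γZ ≪≫ γY.symm, (γY ≪≫ γZ.symm).hom, ?_, by simp⟩
    simp only [DThetaPMBridge.thetaBridgeData, dif_neg hv]
    exact ⟨γY ≪≫ γZ.symm, rfl⟩

/-- At a BAD place, a COLLISION of the kit law for two labels (equal bi-saturated Example-4.4
poly-morphisms) makes the Prop-6.7 composite families at any isomorph `X` of `𝒟_v` coincide for the two
corresponding classes `q₁, q₂ ∈ T^⋆`. ([IUTchI] Prop 6.7 p.167) [claim: Mochizuki2012, status: disputed] -/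
theorem thetaBridgeData_labelFamily_eq_of_collision (hl : Odd l) {v : K.V} (hv : v ∈ K.bad)
    {q₁ q₂ : B.grpT.AbsStar}
    (hcoll : {k : K.model v ⟶ K.model v | ∃ (θ : K.model v ≅ K.model v) (g : K.model v ⟶ K.model v)
        (β : K.model v ≅ K.model v), g ∈ M.thetaPolyBad (B.dBridge.starLabel hl q₁) v hv ∧
          k = θ.hom ≫ g ≫ β.hom} =
      {k : K.model v ⟶ K.model v | ∃ (θ : K.model v ≅ K.model v) (g : K.model v ⟶ K.model v)
        (β : K.model v ≅ K.model v), g ∈ M.thetaPolyBad (B.dBridge.starLabel hl q₂) v hv ∧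
          k = θ.hom ≫ g ≫ β.hom})
    (X : K.Amb v) (hX : K.IsLocal v X) :
    {h : X ⟶ B.codomain.assocD.obj v |
        ∃ (φ : X ≅ ((B.starCapsule q₁).assocD).obj v)
          (g : ((B.starCapsule q₁).assocD).obj v ⟶ B.codomain.assocD.obj v),
          g ∈ (B.dBridge.thetaBridgeData M hl).poly ⟨q₁⟩ v ∧ h = φ.hom ≫ g} =
      {h : X ⟶ B.codomain.assocD.obj v |
        ∃ (φ : X ≅ ((B.starCapsule q₂).assocD).obj v)
          (g : ((B.starCapsule q₂).assocD).obj v ⟶ B.codomain.assocD.obj v),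
          g ∈ (B.dBridge.thetaBridgeData M hl).poly ⟨q₂⟩ v ∧ h = φ.hom ≫ g} := by
  obtain ⟨ψ₀⟩ := hX
  obtain ⟨γ⟩ := B.codomain.assocD.isLocal v
  rw [B.thetaBridgeData_labelFamily_eq hl hv q₁ X, B.thetaBridgeData_labelFamily_eq hl hv q₂ X,
    transport_eq_image_biSaturation ψ₀ γ.symm, transport_eq_image_biSaturation ψ₀ γ.symm, hcoll]

end FKit.ThetaPMBridge

namespace S5Local

variable {l : ℕ} {K : PMBaseKit.{u} l} {M : K.MultKit} {FK : K.FKit M} (N : K.S5Local M FK)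

/-- **Relabelings that preserve the Prop-6.7 families act on gluings.** If `τ` is a permutation of `T^⋆`
under which, for every index `j` and place `v`, the composite family `‡𝒟_{v_j} ⥲ †𝒟_{v_q} → †𝒟_{≻,v}` is
invariant (`q ↦ τ q`), then composing the index bijection of a gluing with `τ` gives a gluing.
([IUTchI] Rmk 6.12.2 (i) p.174) [claim: Mochizuki2012, status: disputed] -/
theorem exists_thetaGluing_trans_of_familyPreserving (hl : Odd l) (B : FK.ThetaPMBridge) (H : N.ThetaNFHT)
    (G : N.ThetaGluing B H hl) (τ : Equiv.Perm B.grpT.AbsStar)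
    (hτ : ∀ (j : N.thJ H) (v : K.V) (q : B.grpT.AbsStar),
      {h : ((N.thCapsule H j).assocD).obj v ⟶ B.codomain.assocD.obj v |
        ∃ (φ : ((N.thCapsule H j).assocD).obj v ≅ ((B.starCapsule (τ q)).assocD).obj v)
          (g : ((B.starCapsule (τ q)).assocD).obj v ⟶ B.codomain.assocD.obj v),
          g ∈ (B.dBridge.thetaBridgeData M hl).poly ⟨τ q⟩ v ∧ h = φ.hom ≫ g} =
      {h : ((N.thCapsule H j).assocD).obj v ⟶ B.codomain.assocD.obj v |
        ∃ (φ : ((N.thCapsule H j).assocD).obj v ≅ ((B.starCapsule q).assocD).obj v)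
          (g : ((B.starCapsule q).assocD).obj v ⟶ B.codomain.assocD.obj v),
          g ∈ (B.dBridge.thetaBridgeData M hl).poly ⟨q⟩ v ∧ h = φ.hom ≫ g}) :
    ∃ G' : N.ThetaGluing B H hl, G'.indexEquiv = G.indexEquiv.trans τ :=
  ⟨⟨G.indexEquiv.trans τ, fun j v => by
      rw [Equiv.trans_apply, hτ j v (G.indexEquiv j)]
      exact G.compat j v⟩, rfl⟩

/-- Hence a NON-TRIVIAL family-preserving relabeling of `T^⋆`, together with ONE gluing, contradicts
the uniqueness of Rmk 6.12.2 (ii). ([IUTchI] Rmk 6.12.2 (ii) p.174) [claim: Mochizuki2012, status: disputed] -/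
theorem not_subsingleton_thetaGluing_of_familyPreserving (hl : Odd l) (B : FK.ThetaPMBridge)
    (H : N.ThetaNFHT) (G : N.ThetaGluing B H hl) (τ : Equiv.Perm B.grpT.AbsStar)
    (hτ1 : τ ≠ Equiv.refl _)
    (hτ : ∀ (j : N.thJ H) (v : K.V) (q : B.grpT.AbsStar),
      {h : ((N.thCapsule H j).assocD).obj v ⟶ B.codomain.assocD.obj v |
        ∃ (φ : ((N.thCapsule H j).assocD).obj v ≅ ((B.starCapsule (τ q)).assocD).obj v)
          (g : ((B.starCapsule (τ q)).assocD).obj v ⟶ B.codomain.assocD.obj v),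
          g ∈ (B.dBridge.thetaBridgeData M hl).poly ⟨τ q⟩ v ∧ h = φ.hom ≫ g} =
      {h : ((N.thCapsule H j).assocD).obj v ⟶ B.codomain.assocD.obj v |
        ∃ (φ : ((N.thCapsule H j).assocD).obj v ≅ ((B.starCapsule q).assocD).obj v)
          (g : ((B.starCapsule q).assocD).obj v ⟶ B.codomain.assocD.obj v),
          g ∈ (B.dBridge.thetaBridgeData M hl).poly ⟨q⟩ v ∧ h = φ.hom ≫ g}) :
    ¬ Subsingleton (N.ThetaGluing B H hl) := by
  intro hS
  obtain ⟨G', hG'⟩ := N.exists_thetaGluing_trans_of_familyPreserving hl B H G τ hτ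
  apply hτ1
  have h := (hS.elim G' G) ▸ hG'
  ext q
  simpa using (Equiv.congr_fun h (G.indexEquiv.symm q)).symm

/-- **Necessity of the kit law (uniform collisions).** If SOME pair `(B, H)` admits a gluing and two
distinct classes `q₁ ≠ q₂ ∈ T^⋆` have COLLIDING kit data at EVERY bad place — equal bi-saturated
Example-4.4 poly-morphisms `Iso(𝒟_v) · thetaPolyBad (label qᵢ) v · Iso(𝒟_v)` — then the transposition
`(q₁ q₂)` preserves all Prop-6.7 families (good places are label-blind, Prop 6.7 / Ex 4.4 (iii)), so the
gluing is NOT unique: `S5Local.GluingUnique` fails.  With `gluingUnique_of_thetaPolyBad_labelRigid`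
this brackets Rmk 6.12.2 (ii) between «the law holds at one bad place» (sufficient) and «the law fails
by the same collision at all bad places» (refuting, given one gluing).
([IUTchI] Rmk 6.12.2 (ii) p.174) [claim: Mochizuki2012, status: disputed] -/
theorem not_gluingUnique_of_uniform_collision (hl : Odd l) (B : FK.ThetaPMBridge) (H : N.ThetaNFHT)
    (G : N.ThetaGluing B H hl) {q₁ q₂ : B.grpT.AbsStar} (hq : q₁ ≠ q₂)
    (hcoll : ∀ (v : K.V) (hv : v ∈ K.bad),
      {k : K.model v ⟶ K.model v | ∃ (θ : K.model v ≅ K.model v) (g : K.model v ⟶ K.model v)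
        (β : K.model v ≅ K.model v), g ∈ M.thetaPolyBad (B.dBridge.starLabel hl q₁) v hv ∧
          k = θ.hom ≫ g ≫ β.hom} =
      {k : K.model v ⟶ K.model v | ∃ (θ : K.model v ≅ K.model v) (g : K.model v ⟶ K.model v)
        (β : K.model v ≅ K.model v), g ∈ M.thetaPolyBad (B.dBridge.starLabel hl q₂) v hv ∧
          k = θ.hom ≫ g ≫ β.hom}) :
    ¬ N.GluingUnique hl := by
  classical
  intro hU
  refine N.not_subsingleton_thetaGluing_of_familyPreserving hl B H G (Equiv.swap q₁ q₂)
    (fun h => hq ((Equiv.swap_eq_refl_iff).mp h)) (fun j v q => ?_) (hU B H)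
  have hX : K.IsLocal v (((N.thCapsule H j).assocD).obj v) := ((N.thCapsule H j).assocD).isLocal v
  by_cases hv : v ∈ K.bad
  · -- bad place: the families are determined by the bi-saturated kit data, which collide for q₁, q₂
    rcases eq_or_ne q q₁ with rfl | h1
    · rw [Equiv.swap_apply_left]
      exact (B.thetaBridgeData_labelFamily_eq_of_collision hl hv (hcoll v hv) _ hX).symm
    · rcases eq_or_ne q q₂ with rfl | h2
      · rw [Equiv.swap_apply_right]
        exact B.thetaBridgeData_labelFamily_eq_of_collision hl hv (hcoll v hv) _ hX
      · rw [Equiv.swap_apply_of_ne_of_ne h1 h2]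
  · -- good place: label-blind
    rw [B.thetaBridgeData_labelFamily_eq_of_not_bad hl hv (Equiv.swap q₁ q₂ q),
      B.thetaBridgeData_labelFamily_eq_of_not_bad hl hv q]

end S5Local


end PMBaseKit

end Literature.IUT.HodgeTheaters
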